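import Mathlib
import Summits.Ventures.PercRepro.TriangleCapRowA2Five
import Summits.Ventures.PercRepro.TriangleCapRowA2Every

/-!
# PercRepro — THE CELL r = a + 2 FOR EVERY ROW a ≥ 5 (the one-triangle gap at a = 5): the theorems of the source module re-derived WITHOUT the bound through
`below_second_order_every` (part 204b) in place of `below_second_order_all` (p3, gen 49; part 204c)

The proofs are those of the source module verbatim; the bound `a ≤ 18` entered them only through the `B2` regime
`below_second_order_all` of part 200zi (the corner `k = 2a + r`, now `below_corner_every`) and through the earlier
rows. Axioms: standard.
-/

namespace PercRepro

namespace TriangleCap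

namespace C047

open Finset

universe u

variable {V : Type*} [Fintype V] [DecidableEq V]

/-- **THE ROW `r = a + 2` BELOW THE CAP, `5 ≤ a`, `3a + 2 ≤ k`:** `K₄⁻`-free, `m + (a + 2) = a (k − a)`, no vertex
of degree `k − a` ⇒ `a`-bipartite or `Σ_v d(v)² + (a + 2)(k − 1 − (a + 2)) + (2k + 2a − 14) ≤ m k` (the whole
assembly of part 201c except the cap, for every row `a ≥ 5`: at `a = 5` the cap alone holds the one-triangle family
`2k − 6`, everything else is at `2k − 4`). -/
theorem rowA2_second_order_nocap_every (D : SimpleGraph V) [DecidableRel D.Adj] (hK : K4mFree D) (a : ℕ)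
    (ha5 : 5 ≤ a) (hk : 3 * a + 2 ≤ Fintype.card V)
    (hm : D.edgeFinset.card + (a + 2) = a * (Fintype.card V - a)) (hx : ∀ x, deg D x + a ≠ Fintype.card V) :
    (∃ A : Finset V, A.card = a ∧ BipSub D A) ∨
      ∑ v, deg D v * deg D v + (a + 2) * (Fintype.card V - 1 - (a + 2)) + (2 * Fintype.card V + 2 * a - 14) ≤
        D.edgeFinset.card * Fintype.card V := by
  have hk2 : 2 * a + 2 ≤ Fintype.card V := by omega
  -- (A) no vertex at the cap
  have hcap : ∀ v, deg D v + a ≤ Fintype.card V := fun v =>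
    deg_add_le_card_of_dense D hK a (by omega) (by omega)
      (cap_arith a (Fintype.card V) D.edgeFinset.card (a + 2) (by omega) (by omega)
        (below_cap_arith a (Fintype.card V) D.edgeFinset.card (a + 2) (by omega) hm)) v
  have hcap' : ∀ v, deg D v + a + 1 ≤ Fintype.card V := fun v => by
    have h1 := hcap v
    have h2 := hx v
    omega
  have hcap2 : ∀ v, deg D v ≤ (Fintype.card V - a - 2) + 1 := fun v => by have := hcap' v; omega
  -- (B) every degree `≥ a`: the window
  by_cases hdeg : ∀ v, a ≤ deg D v
  · exact Or.inr (rowA2_window D a (by omega) hk hm hcap' hdeg)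
  push Not at hdeg
  obtain ⟨z, hz⟩ := hdeg
  -- the deletion bookkeeping: `D − z` on `(k − 1, a, d + 2)`
  have hK' := k4mFree_del D hK z
  have hcard' := card_del z
  have hedges' := card_edges_del D z
  have hsq := sum_deg_sq_del D z
  have hT := sum_del_nbhd_le D z (Fintype.card V - a - 2) hcap2
  obtain ⟨T, hTdef⟩ : ∃ T, ∑ w : {v : V // v ≠ z}, (if D.Adj w.1 z then deg (del D z) w else 0) = T := ⟨_, rfl⟩
  obtain ⟨S', hS'def⟩ : ∃ S', ∑ w : {v : V // v ≠ z}, deg (del D z) w * deg (del D z) w = S' := ⟨_, rfl⟩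
  obtain ⟨m', hm'def⟩ : ∃ m', (del D z).edgeFinset.card = m' := ⟨_, rfl⟩
  rw [hTdef, hS'def] at hsq
  rw [hTdef] at hT
  rw [hm'def] at hedges'
  have hcardV' : Fintype.card {v : V // v ≠ z} = Fintype.card V - 1 := by omega
  have hm' : (del D z).edgeFinset.card + (deg D z + 2) = a * (Fintype.card {v : V // v ≠ z} - a) := by
    rw [hm'def, hcardV']
    exact below_cell_edges a (a + 2) (deg D z + 2) (deg D z) (Fintype.card V) D.edgeFinset.card m' hk2 (by omega)
      hedges' hm
  have hmd : m' + deg D z + (a + 2) = a * (Fintype.card V - a) := by omega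
  have hside : ∀ A' : Finset {v : V // v ≠ z}, A'.card = a → BipSub (del D z) A' →
      (∃ A : Finset V, A.card = a ∧ BipSub D A) ∨
        (∑ v, deg D v * deg D v + (a + 2) * (Fintype.card V - 1 - (a + 2)) + (2 * Fintype.card V + 2 * a - 14) ≤
          D.edgeFinset.card * Fintype.card V) ∨
        (2 ≤ deg D z ∧ T + (Fintype.card V - a - 2) ≤ deg D z * (Fintype.card V - a - 2) + a) := by
    intro A' hA'card hB
    have := sides_A2_gen D a (by omega) hk hm z (by omega) A' hA'card hB hm' hcap2
    rw [hTdef] at this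
    exact this
  rcases Nat.lt_or_ge (deg D z + 4) a with hd5 | hd5
  · -- `d ≤ a − 5`: a `B2` cell `(k − 1, a, d + 2)`
    rcases below_second_order_every (del D z) hK' a (deg D z + 2) (by omega) (by omega) (by omega) hm'
      with ⟨A', hA'card, hB⟩ | hgap
    · rcases hside A' hA'card hB with h | h | ⟨h2, hT'⟩
      · exact Or.inl h
      · exact Or.inr h
      · right
        have hS := sum_deg_sq_le_of_bipSub (del D z) A' hB a (deg D z + 2) hA'card hm' (by omega)
        rw [hS'def, hm'def, hcardV'] at hS
        rw [hsq, ← hedges']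
        exact rowA2_mixed a (deg D z) (Fintype.card V) m' S' T (by omega) h2 (by omega) hk hmd hS hT'
    · right
      rw [hS'def, hm'def, hcardV'] at hgap
      rw [hsq, ← hedges']
      exact rowA2_del_B2 a (deg D z) (Fintype.card V) m' S' T (by omega) (by omega) hk hmd hgap hT
  · rcases Nat.lt_or_ge (deg D z + 3) a with hd4 | hd4
    · -- `d = a − 4`: the `T` cell
      have hda : deg D z = a - 4 := by omega
      have hr' : deg D z + 2 = a - 2 := by omega
      rw [hr'] at hm'
      rw [hda] at hT hedges' hmd
      rcases rowT_second_order_gen_every (del D z) hK' a (a - 2) (by omega) (by omega) (by omega) hm'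
        with ⟨A', hA'card, hB⟩ | hgap
      · rw [← hr'] at hm'
        rcases hside A' hA'card hB with h | h | ⟨h2, hT'⟩
        · exact Or.inl h
        · exact Or.inr h
        · right
          have hS := sum_deg_sq_le_of_bipSub (del D z) A' hB a (deg D z + 2) hA'card hm' (by omega)
          rw [hS'def, hm'def, hcardV'] at hS
          rw [hda] at hT' h2 hS
          rw [hsq, ← hedges', hda]
          exact rowA2_mixed a (a - 4) (Fintype.card V) m' S' T (by omega) h2 (by omega) hk hmd hS hT'
      · right
        rw [hS'def, hm'def, hcardV'] at hgap
        rw [hsq, ← hedges', hda]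
        exact rowA2_del_T a (Fintype.card V) m' S' T (by omega) hk hmd hgap hT
    · rcases Nat.lt_or_ge (deg D z + 2) a with hd3 | hd3
      · -- `d = a − 3`: the `B2` cell `r′ = a − 1`
        have hda : deg D z = a - 3 := by omega
        have hr' : deg D z + 2 = a - 1 := by omega
        rw [hr'] at hm'
        rw [hda] at hT hedges' hmd
        rcases rowB_second_order_all_every (del D z) hK' a (a - 1) (by omega) (by omega) (by omega) hm'
          with ⟨A', hA'card, hB⟩ | hgap
        · rw [← hr'] at hm'
          rcases hside A' hA'card hB with h | h | ⟨h2, hT'⟩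
          · exact Or.inl h
          · exact Or.inr h
          · right
            have hS := sum_deg_sq_le_of_bipSub (del D z) A' hB a (deg D z + 2) hA'card hm' (by omega)
            rw [hS'def, hm'def, hcardV'] at hS
            rw [hda] at hT' h2 hS
            rw [hsq, ← hedges', hda]
            exact rowA2_mixed a (a - 3) (Fintype.card V) m' S' T (by omega) h2 (by omega) hk hmd hS hT'
        · right
          rw [hS'def, hm'def, hcardV'] at hgap
          rw [hsq, ← hedges', hda]
          exact rowA2_del_B a (Fintype.card V) m' S' T (by omega) hk hmd hgap hT
      · rcases Nat.lt_or_ge (deg D z + 1) a with hd2 | hd2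
        · -- `d = a − 2`: the cell `r′ = a` and the finer mixed read
          have hda : deg D z = a - 2 := by omega
          have hm'a : (del D z).edgeFinset.card + a = a * (Fintype.card {v : V // v ≠ z} - a) := by
            have h := hm'
            rw [hda] at h
            have e : a - 2 + 2 = a := by omega
            rw [e] at h
            exact h
          rcases rowA_second_order_gen_every (del D z) hK' a (by omega) (by omega) hm'a
            with ⟨A', hA'card, hB⟩ | hgap
          · by_cases hall : ∀ w : {v : V // v ≠ z}, D.Adj w.1 z → w ∈ A'
            · obtain ⟨B, hBcard, hBsub⟩ := bipSub_lift D z A' hB hall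
              exact Or.inl ⟨B, by rw [hBcard, hA'card], hBsub⟩
            push Not at hall
            obtain ⟨w₀, hw₀z, hw₀A⟩ := hall
            by_cases hnone : ∀ w : {v : V // v ≠ z}, D.Adj w.1 z → w ∉ A'
            · exact Or.inr (rowA2_alloff D a (by omega) hk hm z (by omega) A' hA'card hB hm' hnone w₀ hw₀z)
            push Not at hnone
            obtain ⟨w₁, hw₁z, hw₁A⟩ := hnone
            exact Or.inr (rowA2_last_mixed_two' D hK a ha5 hk hm z hda A' hA'card hB hm' hcap2 w₀ hw₀A hw₀z w₁
              hw₁A hw₁z)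
          · right
            rw [hS'def, hm'def, hcardV'] at hgap
            rw [hda] at hT hedges' hmd
            rw [hsq, ← hedges', hda]
            exact rowA2_del_A a (Fintype.card V) m' S' T (by omega) hk hmd hgap hT
        · -- `d = a − 1`: the cell `r′ = a + 1` and the finer mixed read
          have hda : deg D z = a - 1 := by omega
          have hm'a : (del D z).edgeFinset.card + (a + 1) = a * (Fintype.card {v : V // v ≠ z} - a) := by
            have h := hm'
            rw [hda] at h
            have e : a - 1 + 2 = a + 1 := by omega
            rw [e] at h
            exact h
          rcases rowA1_second_order_gen''_every (del D z) hK' a (by omega) (by omega) hm'a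
            with ⟨A', hA'card, hB⟩ | hgap
          · by_cases hall : ∀ w : {v : V // v ≠ z}, D.Adj w.1 z → w ∈ A'
            · obtain ⟨B, hBcard, hBsub⟩ := bipSub_lift D z A' hB hall
              exact Or.inl ⟨B, by rw [hBcard, hA'card], hBsub⟩
            push Not at hall
            obtain ⟨w₀, hw₀z, hw₀A⟩ := hall
            by_cases hnone : ∀ w : {v : V // v ≠ z}, D.Adj w.1 z → w ∉ A'
            · exact Or.inr (rowA2_alloff D a (by omega) hk hm z (by omega) A' hA'card hB hm' hnone w₀ hw₀z)
            push Not at hnone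
            obtain ⟨w₁, hw₁z, hw₁A⟩ := hnone
            exact Or.inr (rowA2_last_mixed_one' D hK a ha5 hk hm z hda A' hA'card hB hm' hcap2 w₀ hw₀A hw₀z w₁
              hw₁A hw₁z)
          · right
            rw [hS'def, hm'def, hcardV'] at hgap
            rw [hda] at hT hedges' hmd
            rw [hsq, ← hedges', hda]
            exact rowA2_del_A1 a (Fintype.card V) m' S' T (by omega) hk hmd hgap hT

/-- **THE ROW `r = a + 2` ON EVERY ROW `5 ≤ a`, `3a + 2 ≤ k`, AT THE GAP `min (2k + 2a − 14) (2k + 4a − 26)`:**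
`K₄⁻`-free, `m + (a + 2) = a (k − a)` ⇒ `a`-bipartite or
`Σ_v d(v)² + (a + 2)(k − 1 − (a + 2)) + min (2k + 2a − 14) (2k + 4a − 26) ≤ m k`. -/
theorem rowA2_second_order_min_every (D : SimpleGraph V) [DecidableRel D.Adj] (hK : K4mFree D) (a : ℕ)
    (ha5 : 5 ≤ a) (hk : 3 * a + 2 ≤ Fintype.card V)
    (hm : D.edgeFinset.card + (a + 2) = a * (Fintype.card V - a)) :
    (∃ A : Finset V, A.card = a ∧ BipSub D A) ∨
      ∑ v, deg D v * deg D v + (a + 2) * (Fintype.card V - 1 - (a + 2)) +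
          min (2 * Fintype.card V + 2 * a - 14) (2 * Fintype.card V + 4 * a - 26) ≤
        D.edgeFinset.card * Fintype.card V := by
  by_cases hx : ∃ x, deg D x + a = Fintype.card V
  · obtain ⟨x, hx⟩ := hx
    rcases Nat.lt_or_ge a 6 with ha | ha
    · -- `a = 5`: the cap at the one-triangle gap `2k − 6`
      have ha5' : a = 5 := by omega
      rcases cap_A2_five D hK a ha5 (by omega) hk hm x hx with h | h
      · exact Or.inl h
      · right
        have hmin : min (2 * Fintype.card V + 2 * a - 14) (2 * Fintype.card V + 4 * a - 26) =
            2 * Fintype.card V - 6 := by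
          rw [ha5']
          omega
        rw [hmin]
        exact h
    · rcases cap_A2_gen' D hK a ha hk hm x hx with h | h
      · exact Or.inl h
      · right
        have hmin : min (2 * Fintype.card V + 2 * a - 14) (2 * Fintype.card V + 4 * a - 26) =
            2 * Fintype.card V + 2 * a - 14 := by omega
        rw [hmin]
        exact h
  · push Not at hx
    rcases rowA2_second_order_nocap_every D hK a ha5 hk hm hx with h | h
    · exact Or.inl h
    · right
      have hmin : min (2 * Fintype.card V + 2 * a - 14) (2 * Fintype.card V + 4 * a - 26) ≤
          2 * Fintype.card V + 2 * a - 14 := min_le_left _ _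
      omega

/-- **THE ROW `a = 5` AT `r = 7`, `17 ≤ k`:** `K₄⁻`-free, `m + 7 = 5 (k − 5)` ⇒ `5`-bipartite or
`Σ_v d(v)² + 7 (k − 8) + (2k − 6) ≤ m k` — the one-triangle gap, below the triple broom's `2k − 4`. -/
theorem rowA2_second_order_five_every (D : SimpleGraph V) [DecidableRel D.Adj] (hK : K4mFree D)
    (hk : 17 ≤ Fintype.card V) (hm : D.edgeFinset.card + 7 = 5 * (Fintype.card V - 5)) :
    (∃ A : Finset V, A.card = 5 ∧ BipSub D A) ∨
      ∑ v, deg D v * deg D v + 7 * (Fintype.card V - 1 - 7) + (2 * Fintype.card V - 6) ≤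
        D.edgeFinset.card * Fintype.card V := by
  rcases rowA2_second_order_min_every D hK 5 (le_refl 5) (by omega) hm with h | h
  · exact Or.inl h
  · right
    have hmin : min (2 * Fintype.card V + 2 * 5 - 14) (2 * Fintype.card V + 4 * 5 - 26) =
        2 * Fintype.card V - 6 := by omega
    rw [hmin] at h
    exact h

end C047

end TriangleCap

end PercRepro
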